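import Summits.Ventures.YMGap.FlowData.LinkCharacterMerging
import Summits.Ventures.LatticeQCDFlow.Scoring.FinitePiSeriesProduct
import HarnessLib

/-!
# Venture YMGap, track Y3 FLOW-DATA — the product Wilson weight of an SU(2) time slice as a multi-character
# series, and the series of the electric bilinear form `∫∫ ψ(a) W(a,b) h(b)` (theorems only)

HONEST FRAMING: venture file of the cell `pub-ymgap` (QuantumFields programme), track Y3; companion THEOREMS for
`FlowData/TubeTransferOperator.lean` preparing the STRONG-COUPLING WINDOW for the typed torelon energy
(`FlowData/TubeStrongCouplingWindow.lean`).  Finite Haar integrals over `SU(2)^{links}`; no number, no row, nothing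
about limits or a mass gap.  NO Peter–Weyl: the ONE function `e^{β a₀}` is expanded (`SU2WeightCharacterSeries`,
at every group element) and finite products of absolutely convergent series are multiplied out
(`LatticeQCDFlow/Scoring/FinitePiSeriesProduct`).

Notation of the docstrings (spelled out in the statements): `c_n(β) = I_n(β) − I_{n+2}(β)`, `q_n = c_n/(n+1)`,
`W(a, b) = ∏_e e^{β a₀(b_e a_e⁻¹)}` (the un-averaged electric weight between two slices at temporal links `1`,
`exp_elecSum_one_eq_prod`), `X_ν(a, b) = ∏_e χ_{ν_e}(b_e a_e⁻¹)`, `d_ν = ∏_e (ν_e + 1)`,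
`(p_ν h)(a) = d_ν ∫ X_ν(a, b) h(b) db`.

* `summable_norm_prod_and_tsum_eq_prod` — finite products of absolutely convergent series over a finite index TYPE
  (the prior venture's `Fin k` statement transported), in a complete normed commutative ring;
* **`hasSum_prod_weight_characterSeries`** — `W(a, b) = Σ_ν ∏_e c_{ν_e}(β) χ_{ν_e}(b_e a_e⁻¹)` at EVERY pair of
  slices (`β ≥ 0`), with the uniform domination `Σ_ν ∏_e (ν_e+1) c_{ν_e} = (Σ_n (n+1) c_n)^{#links} < ∞`
  (`summable_prod_succ_mul_besselISub`, `abs_prod_coeff_mul_character_le`);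
* `integral_weight_mul_eq_tsum` — `∫ W(a, b) h(b) db = Σ_ν q_ν · (p_ν h)(a)` for integrable `h` (term-by-term
  integration, dominated by `(Σ(n+1)c_n)^{#links} ∫|h|`), `q_ν = ∏_e q_{ν_e}`;
* **`integral_mul_integral_weight_mul_eq_tsum`** — THE BILINEAR FORM AS A SERIES:
  `∫ ψ(a) ∫ W(a,b) h(b) db da = Σ_ν q_ν ∫ ψ · p_ν h` for integrable `ψ, h`, the series converging absolutely
  (`summable_abs_coeff_mul_integral_mul_charProj`).

References: I. Montvay, G. Münster (1994) §3.2.6, §3.4.2 [cite: MontvayMunster1994, §3.4.2]; J.-M. Drouffe,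
J.-B. Zuber, Phys. Rept. 102 (1983) 1, §3 [cite: DrouffeZuber1983, §3].
-/

noncomputable section

open scoped BigOperators Topology
open MeasureTheory Filter Function Set Polynomial.Chebyshev
open Literature.MathematicalPhysics.QuantumFieldTheory Literature.MathematicalPhysics.QuantumLattice Literature.Analysis.FunctionSpaces
open Literature.Analysis.OperatorTheory
open Summit.Ventures.LatticeQCDFlow.Exactness Summit.Ventures.LatticeQCDFlow.Scoring

namespace Summit.Ventures.YMGap.FlowData.SU2Links

/-! ### Finite products of absolutely convergent series over a finite index type -/

section PiSeries

/-- **Finite products of absolutely convergent series, finite index type**: for `f : ι → ℕ → R` with every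
`Σ_n ‖f i n‖ < ∞` the multi-series `x ↦ ∏_i f i (x i)` on `ι → ℕ` is absolutely summable and
`Σ'_x ∏_i f i (x i) = ∏_i Σ'_n f i n` (the prior venture's `summable_norm_prod_pi_and_tsum` along `ι ≃ Fin |ι|`).
[folklore] -/
theorem summable_norm_prod_and_tsum_eq_prod {R : Type*} [NormedCommRing R] [CompleteSpace R]
    {ι : Type*} [Fintype ι] (f : ι → ℕ → R) (hf : ∀ i, Summable fun n => ‖f i n‖) :
    (Summable fun x : ι → ℕ => ‖∏ i, f i (x i)‖) ∧ ∑' x : ι → ℕ, ∏ i, f i (x i) = ∏ i, ∑' n, f i n := by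
  classical
  set e : ι ≃ Fin (Fintype.card ι) := Fintype.equivFin ι with he
  have hfin := summable_norm_prod_pi_and_tsum (Fintype.card ι) (fun j => f (e.symm j)) (fun j => hf _)
  set Φ : (ι → ℕ) ≃ (Fin (Fintype.card ι) → ℕ) := Equiv.piCongrLeft' (fun _ : ι => ℕ) e with hΦ
  have hterm : ∀ x : ι → ℕ, ∏ j, f (e.symm j) ((Φ x) j) = ∏ i, f i (x i) := by
    intro x
    simp only [hΦ, Equiv.piCongrLeft'_apply]
    exact e.symm.prod_comp (fun i => f i (x i))
  constructor
  · have h1 := (Φ.summable_iff (f := fun y : Fin (Fintype.card ι) → ℕ => ‖∏ j, f (e.symm j) (y j)‖)).2 hfin.1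
    refine h1.congr fun x => ?_
    simp only [comp_apply, hterm]
  · rw [← e.symm.prod_comp (fun i => ∑' n, f i n), ← hfin.2, ← Φ.tsum_eq (fun y => ∏ j, f (e.symm j) (y j))]
    exact tsum_congr fun x => (hterm x).symm

end PiSeries

/-! ### The product weight as a multi-character series -/

section Weight

variable {ι : Type*} [Fintype ι]

/-- `|∏_e c_{ν_e} χ_{ν_e}(g_e)| ≤ ∏_e (ν_e + 1) c_{ν_e}` (`β ≥ 0`, so that `c_n ≥ 0`). [folklore] -/
theorem abs_prod_coeff_mul_character_le {β : ℝ} (hβ : 0 ≤ β) (ν : ι → ℕ)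
    (g : ι → Matrix.specialUnitaryGroup (Fin 2) ℂ) :
    |∏ e, ((besselI (ν e) β - besselI (ν e + 2) β) * (U ℝ (ν e)).eval (su2a0 (g e)))| ≤
      ∏ e, (((ν e : ℝ) + 1) * (besselI (ν e) β - besselI (ν e + 2) β)) := by
  rw [Finset.abs_prod]
  refine Finset.prod_le_prod (fun e _ => abs_nonneg _) fun e _ => ?_
  rw [abs_mul, abs_of_nonneg (besselISub_nonneg hβ _), mul_comm]
  exact mul_le_mul_of_nonneg_right (abs_su2Character_le _ _) (besselISub_nonneg hβ _)

/-- **The uniform domination**: `Σ_ν ∏_e (ν_e + 1) c_{ν_e}(β) < ∞` and it equals `(Σ_n (n+1) c_n(β))^{#links}`.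
[folklore] -/
theorem summable_prod_succ_mul_besselISub {β : ℝ} (hβ : 0 ≤ β) :
    (Summable fun ν : ι → ℕ => ∏ e, (((ν e : ℝ) + 1) * (besselI (ν e) β - besselI (ν e + 2) β))) ∧
      ∑' ν : ι → ℕ, ∏ e, (((ν e : ℝ) + 1) * (besselI (ν e) β - besselI (ν e + 2) β)) =
        (∑' n : ℕ, ((n : ℝ) + 1) * (besselI n β - besselI (n + 2) β)) ^ Fintype.card (ι) := by
  have h0 : ∀ n : ℕ, 0 ≤ ((n : ℝ) + 1) * (besselI n β - besselI (n + 2) β) := fun n =>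
    mul_nonneg (by positivity) (besselISub_nonneg hβ n)
  have hs : ∀ _e : ι, Summable fun n : ℕ => ‖((n : ℝ) + 1) * (besselI n β - besselI (n + 2) β)‖ :=
    fun _ => (summable_succ_mul_besselISub hβ).norm
  have h := summable_norm_prod_and_tsum_eq_prod
    (fun (_ : ι) (n : ℕ) => ((n : ℝ) + 1) * (besselI n β - besselI (n + 2) β)) hs
  refine ⟨h.1.of_norm, ?_⟩
  rw [h.2, Finset.prod_const, Finset.card_univ]

/-- **THE PRODUCT WEIGHT AS A MULTI-CHARACTER SERIES, at every pair of slices**: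
`∏_e e^{β a₀(g_e)} = Σ_ν ∏_e c_{ν_e}(β) χ_{ν_e}(g_e)` (`β ≥ 0`). [cite: MontvayMunster1994, §3.4.2] -/
theorem hasSum_prod_weight_characterSeries {β : ℝ} (hβ : 0 ≤ β)
    (g : ι → Matrix.specialUnitaryGroup (Fin 2) ℂ) :
    HasSum (fun ν : ι → ℕ => ∏ e, ((besselI (ν e) β - besselI (ν e + 2) β) * (U ℝ (ν e)).eval (su2a0 (g e))))
      (∏ e, Real.exp (β * su2a0 (g e))) := by
  have hs : ∀ e : ι, Summable fun n : ℕ =>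
      ‖(besselI n β - besselI (n + 2) β) * (U ℝ n).eval (su2a0 (g e))‖ := fun e => by
    refine Summable.of_nonneg_of_le (fun n => norm_nonneg _) (fun n => ?_) (summable_succ_mul_besselISub hβ)
    rw [Real.norm_eq_abs, abs_mul, abs_of_nonneg (besselISub_nonneg hβ n), mul_comm]
    exact mul_le_mul_of_nonneg_right (abs_su2Character_le n _) (besselISub_nonneg hβ n)
  have h := summable_norm_prod_and_tsum_eq_prod
    (fun (e : ι) (n : ℕ) => (besselI n β - besselI (n + 2) β) * (U ℝ n).eval (su2a0 (g e))) hs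
  have hsum : ∀ e : ι, ∑' n : ℕ, (besselI n β - besselI (n + 2) β) * (U ℝ n).eval (su2a0 (g e)) =
      Real.exp (β * su2a0 (g e)) := fun e => (hasSum_besselISub_mul_su2Character hβ (g e)).tsum_eq
  have h2 : ∑' ν : ι → ℕ, ∏ e, ((besselI (ν e) β - besselI (ν e + 2) β) * (U ℝ (ν e)).eval (su2a0 (g e))) =
      ∏ e, Real.exp (β * su2a0 (g e)) := by
    rw [h.2]
    exact Finset.prod_congr rfl fun e _ => hsum e
  rw [← h2]
  exact h.1.of_norm.hasSum

/-- Splitting a term of the series: `∏_e c_{ν_e} χ_{ν_e}(g_e) = (∏_e q_{ν_e}) · d_ν · X_ν(g)` with `q_n = c_n/(n+1)`.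
[folklore] -/
theorem prod_coeff_mul_character_eq {β : ℝ} (ν : ι → ℕ)
    (g : ι → Matrix.specialUnitaryGroup (Fin 2) ℂ) :
    ∏ e, ((besselI (ν e) β - besselI (ν e + 2) β) * (U ℝ (ν e)).eval (su2a0 (g e))) =
      (∏ e, (besselI (ν e) β - besselI (ν e + 2) β) / ((ν e : ℝ) + 1)) *
        ((∏ e, ((ν e : ℝ) + 1)) * ∏ e, (U ℝ (ν e)).eval (su2a0 (g e))) := by
  rw [← mul_assoc, ← Finset.prod_mul_distrib, ← Finset.prod_mul_distrib]
  refine Finset.prod_congr rfl fun e _ => ?_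
  have hn : ((ν e : ℝ) + 1) ≠ 0 := by positivity
  rw [div_mul_cancel₀ _ hn]

/-- The coefficient identity `(∏_e q_{ν_e}) d_ν² = ∏_e (ν_e+1) c_{ν_e}`. [folklore] -/
theorem prod_div_succ_mul_prod_succ_sq {β : ℝ} (ν : ι → ℕ) :
    (∏ e, (besselI (ν e) β - besselI (ν e + 2) β) / ((ν e : ℝ) + 1)) * (∏ e, ((ν e : ℝ) + 1)) ^ 2 =
      ∏ e, (((ν e : ℝ) + 1) * (besselI (ν e) β - besselI (ν e + 2) β)) := by
  rw [sq, ← mul_assoc, ← Finset.prod_mul_distrib, ← Finset.prod_mul_distrib]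
  refine Finset.prod_congr rfl fun e _ => ?_
  have hn : ((ν e : ℝ) + 1) ≠ 0 := by positivity
  rw [div_mul_cancel₀ _ hn, mul_comm]

/-- `0 ≤ ∏_e q_{ν_e}` for `β ≥ 0`. [folklore] -/
theorem prod_div_succ_nonneg {β : ℝ} (hβ : 0 ≤ β) (ν : ι → ℕ) :
    0 ≤ ∏ e, (besselI (ν e) β - besselI (ν e + 2) β) / ((ν e : ℝ) + 1) :=
  Finset.prod_nonneg fun e _ => div_nonneg (besselISub_nonneg hβ _) (by positivity)

/-! ### Term-by-term integration: one slice, then the bilinear form -/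

/-- **`∫ W(a, b) h(b) db = Σ_ν q_ν (p_ν h)(a)`** for integrable `h` and every `a` (`β ≥ 0`): expand the weight at
every `b`, integrate term by term (domination `(Σ(n+1)c_n)^{#links} ∫|h|`). [cite: MontvayMunster1994, §3.4.2] -/
theorem integral_weight_mul_eq_tsum {β : ℝ} (hβ : 0 ≤ β)
    {h : (ι → Matrix.specialUnitaryGroup (Fin 2) ℂ) → ℝ}
    (hh : Integrable h ((Measure.pi fun _ : ι => haarProbability (Matrix.specialUnitaryGroup (Fin 2) ℂ))))
    (a : (ι → Matrix.specialUnitaryGroup (Fin 2) ℂ)) :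
    ∫ b, (∏ e, Real.exp (β * su2a0 (b e * (a e)⁻¹))) * h b ∂((Measure.pi fun _ : ι => haarProbability (Matrix.specialUnitaryGroup (Fin 2) ℂ))) =
      ∑' ν : ι → ℕ, (∏ e, (besselI (ν e) β - besselI (ν e + 2) β) / ((ν e : ℝ) + 1)) *
        ((∏ e, ((ν e : ℝ) + 1)) * ∫ b, (∏ e, (U ℝ (ν e)).eval (su2a0 (b e * (a e)⁻¹))) * h b
          ∂((Measure.pi fun _ : ι => haarProbability (Matrix.specialUnitaryGroup (Fin 2) ℂ)))) := by
  set μ := (Measure.pi fun _ : ι => haarProbability (Matrix.specialUnitaryGroup (Fin 2) ℂ)) with hμ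
  -- the terms and their domination
  set T : (ι → ℕ) → (ι → Matrix.specialUnitaryGroup (Fin 2) ℂ) → ℝ := fun ν b =>
    (∏ e, ((besselI (ν e) β - besselI (ν e + 2) β) * (U ℝ (ν e)).eval (su2a0 (b e * (a e)⁻¹)))) * h b with hT
  have hexp : ∀ b : (ι → Matrix.specialUnitaryGroup (Fin 2) ℂ),
      (∏ e, Real.exp (β * su2a0 (b e * (a e)⁻¹))) * h b = ∑' ν : ι → ℕ, T ν b := by
    intro b
    rw [← (hasSum_prod_weight_characterSeries hβ (fun e => b e * (a e)⁻¹)).tsum_eq, ← tsum_mul_right]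
  simp_rw [hexp]
  have hTc : ∀ ν : ι → ℕ, Continuous fun b : (ι → Matrix.specialUnitaryGroup (Fin 2) ℂ) =>
      ∏ e, ((besselI (ν e) β - besselI (ν e + 2) β) * (U ℝ (ν e)).eval (su2a0 (b e * (a e)⁻¹))) := fun ν =>
    continuous_finsetProd _ fun e _ => continuous_const.mul
      ((continuous_su2Character (ν e)).comp ((continuous_apply e).mul continuous_const))
  have hTi : ∀ ν, Integrable (T ν) μ := fun ν =>
    hh.bdd_mul (hTc ν).aestronglyMeasurable (Eventually.of_forall fun b => by
      rw [Real.norm_eq_abs]; exact abs_prod_coeff_mul_character_le hβ ν _)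
  have hTn : Summable fun ν : ι → ℕ => ∫ b, ‖T ν b‖ ∂μ := by
    refine Summable.of_nonneg_of_le (fun ν => integral_nonneg fun b => norm_nonneg _) (fun ν => ?_)
      ((summable_prod_succ_mul_besselISub (ι := ι) hβ).1.mul_right (∫ b, |h b| ∂μ))
    rw [← integral_const_mul]
    refine integral_mono_of_nonneg (Eventually.of_forall fun b => norm_nonneg _) (hh.abs.const_mul _)
      (Eventually.of_forall fun b => ?_)
    simp only [hT]
    rw [norm_mul, Real.norm_eq_abs, Real.norm_eq_abs]
    exact mul_le_mul_of_nonneg_right (abs_prod_coeff_mul_character_le hβ ν _) (abs_nonneg _)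
  rw [← integral_tsum_of_summable_integral_norm hTi hTn]
  refine tsum_congr fun ν => ?_
  simp only [hT]
  simp_rw [prod_coeff_mul_character_eq ν]
  simp_rw [mul_assoc]
  rw [integral_const_mul, integral_const_mul]

/-- The terms of the bilinear series are dominated: `|q_ν ∫ ψ · p_ν h| ≤ (∏_e (ν_e+1) c_{ν_e}) ∫|ψ| ∫|h|`. [folklore] -/
theorem abs_coeff_mul_integral_mul_charProj_le {β : ℝ} (hβ : 0 ≤ β) (ν : ι → ℕ)
    {ψ h : (ι → Matrix.specialUnitaryGroup (Fin 2) ℂ) → ℝ}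
    (hψ : Integrable ψ ((Measure.pi fun _ : ι => haarProbability (Matrix.specialUnitaryGroup (Fin 2) ℂ))))
    (hh : Integrable h ((Measure.pi fun _ : ι => haarProbability (Matrix.specialUnitaryGroup (Fin 2) ℂ)))) :
    |(∏ e, (besselI (ν e) β - besselI (ν e + 2) β) / ((ν e : ℝ) + 1)) *
        ∫ a, ψ a * ((∏ e, ((ν e : ℝ) + 1)) * ∫ b, (∏ e, (U ℝ (ν e)).eval (su2a0 (b e * (a e)⁻¹))) * h b
          ∂((Measure.pi fun _ : ι => haarProbability (Matrix.specialUnitaryGroup (Fin 2) ℂ))))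
          ∂((Measure.pi fun _ : ι => haarProbability (Matrix.specialUnitaryGroup (Fin 2) ℂ)))| ≤
      (∏ e, (((ν e : ℝ) + 1) * (besselI (ν e) β - besselI (ν e + 2) β))) *
        ((∫ a, |ψ a| ∂((Measure.pi fun _ : ι => haarProbability (Matrix.specialUnitaryGroup (Fin 2) ℂ)))) *
          ∫ b, |h b| ∂((Measure.pi fun _ : ι => haarProbability (Matrix.specialUnitaryGroup (Fin 2) ℂ)))) := by
  set μ := (Measure.pi fun _ : ι => haarProbability (Matrix.specialUnitaryGroup (Fin 2) ℂ)) with hμ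
  set P : (ι → Matrix.specialUnitaryGroup (Fin 2) ℂ) → ℝ := fun a =>
    (∏ e, ((ν e : ℝ) + 1)) * ∫ b, (∏ e, (U ℝ (ν e)).eval (su2a0 (b e * (a e)⁻¹))) * h b ∂μ with hP
  have hPb : ∀ a, |P a| ≤ (∏ e, ((ν e : ℝ) + 1)) ^ 2 * ∫ b, |h b| ∂μ := fun a => abs_charProj_le ν hh a
  have h1 : |∫ a, ψ a * P a ∂μ| ≤ ((∏ e, ((ν e : ℝ) + 1)) ^ 2 * ∫ b, |h b| ∂μ) * ∫ a, |ψ a| ∂μ := by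
    rw [← integral_const_mul, ← Real.norm_eq_abs]
    refine norm_integral_le_of_norm_le (hψ.abs.const_mul _) (Eventually.of_forall fun a => ?_)
    rw [norm_mul, Real.norm_eq_abs, Real.norm_eq_abs, mul_comm]
    exact mul_le_mul_of_nonneg_right (hPb a) (abs_nonneg _)
  rw [abs_mul, abs_of_nonneg (prod_div_succ_nonneg hβ ν)]
  calc (∏ e, (besselI (ν e) β - besselI (ν e + 2) β) / ((ν e : ℝ) + 1)) * |∫ a, ψ a * P a ∂μ|
      ≤ (∏ e, (besselI (ν e) β - besselI (ν e + 2) β) / ((ν e : ℝ) + 1)) *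
          (((∏ e, ((ν e : ℝ) + 1)) ^ 2 * ∫ b, |h b| ∂μ) * ∫ a, |ψ a| ∂μ) :=
        mul_le_mul_of_nonneg_left h1 (prod_div_succ_nonneg hβ ν)
    _ = (∏ e, (besselI (ν e) β - besselI (ν e + 2) β) / ((ν e : ℝ) + 1)) * (∏ e, ((ν e : ℝ) + 1)) ^ 2 *
          ((∫ a, |ψ a| ∂μ) * ∫ b, |h b| ∂μ) := by ring
    _ = (∏ e, (((ν e : ℝ) + 1) * (besselI (ν e) β - besselI (ν e + 2) β))) *
          ((∫ a, |ψ a| ∂μ) * ∫ b, |h b| ∂μ) := by rw [prod_div_succ_mul_prod_succ_sq]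

/-- **Absolute convergence of the bilinear series** `Σ_ν |q_ν ∫ ψ · p_ν h| < ∞`. [folklore] -/
theorem summable_abs_coeff_mul_integral_mul_charProj {β : ℝ} (hβ : 0 ≤ β)
    {ψ h : (ι → Matrix.specialUnitaryGroup (Fin 2) ℂ) → ℝ}
    (hψ : Integrable ψ ((Measure.pi fun _ : ι => haarProbability (Matrix.specialUnitaryGroup (Fin 2) ℂ))))
    (hh : Integrable h ((Measure.pi fun _ : ι => haarProbability (Matrix.specialUnitaryGroup (Fin 2) ℂ)))) :
    Summable fun ν : ι → ℕ => |(∏ e, (besselI (ν e) β - besselI (ν e + 2) β) / ((ν e : ℝ) + 1)) *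
        ∫ a, ψ a * ((∏ e, ((ν e : ℝ) + 1)) * ∫ b, (∏ e, (U ℝ (ν e)).eval (su2a0 (b e * (a e)⁻¹))) * h b
          ∂((Measure.pi fun _ : ι => haarProbability (Matrix.specialUnitaryGroup (Fin 2) ℂ))))
          ∂((Measure.pi fun _ : ι => haarProbability (Matrix.specialUnitaryGroup (Fin 2) ℂ)))| :=
  Summable.of_nonneg_of_le (fun _ => abs_nonneg _) (fun ν => abs_coeff_mul_integral_mul_charProj_le hβ ν hψ hh)
    ((summable_prod_succ_mul_besselISub (ι := ι) hβ).1.mul_right _)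

/-- **THE ELECTRIC BILINEAR FORM AS A SERIES**: for integrable `ψ, h` and `β ≥ 0`,
`∫ ψ(a) (∫ W(a, b) h(b) db) da = Σ_ν q_ν ∫ ψ · p_ν h`, `q_ν = ∏_e c_{ν_e}(β)/(ν_e+1)`.
[cite: MontvayMunster1994, §3.4.2] -/
theorem integral_mul_integral_weight_mul_eq_tsum {β : ℝ} (hβ : 0 ≤ β)
    {ψ h : (ι → Matrix.specialUnitaryGroup (Fin 2) ℂ) → ℝ}
    (hψ : Integrable ψ ((Measure.pi fun _ : ι => haarProbability (Matrix.specialUnitaryGroup (Fin 2) ℂ))))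
    (hh : Integrable h ((Measure.pi fun _ : ι => haarProbability (Matrix.specialUnitaryGroup (Fin 2) ℂ)))) :
    ∫ a, ψ a * ∫ b, (∏ e, Real.exp (β * su2a0 (b e * (a e)⁻¹))) * h b
        ∂((Measure.pi fun _ : ι => haarProbability (Matrix.specialUnitaryGroup (Fin 2) ℂ))) ∂((Measure.pi fun _ : ι => haarProbability (Matrix.specialUnitaryGroup (Fin 2) ℂ))) =
      ∑' ν : ι → ℕ, (∏ e, (besselI (ν e) β - besselI (ν e + 2) β) / ((ν e : ℝ) + 1)) *
        ∫ a, ψ a * ((∏ e, ((ν e : ℝ) + 1)) * ∫ b, (∏ e, (U ℝ (ν e)).eval (su2a0 (b e * (a e)⁻¹))) * h b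
          ∂((Measure.pi fun _ : ι => haarProbability (Matrix.specialUnitaryGroup (Fin 2) ℂ))))
          ∂((Measure.pi fun _ : ι => haarProbability (Matrix.specialUnitaryGroup (Fin 2) ℂ))) := by
  set μ := (Measure.pi fun _ : ι => haarProbability (Matrix.specialUnitaryGroup (Fin 2) ℂ)) with hμ
  -- the inner integral as a series, at every `a`
  set S : (ι → ℕ) → (ι → Matrix.specialUnitaryGroup (Fin 2) ℂ) → ℝ := fun ν a =>
    ψ a * ((∏ e, (besselI (ν e) β - besselI (ν e + 2) β) / ((ν e : ℝ) + 1)) *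
      ((∏ e, ((ν e : ℝ) + 1)) * ∫ b, (∏ e, (U ℝ (ν e)).eval (su2a0 (b e * (a e)⁻¹))) * h b ∂μ)) with hS
  have hinner : ∀ a : (ι → Matrix.specialUnitaryGroup (Fin 2) ℂ),
      ψ a * ∫ b, (∏ e, Real.exp (β * su2a0 (b e * (a e)⁻¹))) * h b ∂μ = ∑' ν : ι → ℕ, S ν a := by
    intro a
    rw [integral_weight_mul_eq_tsum hβ hh a, ← tsum_mul_left]
  simp_rw [hinner]
  -- domination of the outer series
  have hPc : ∀ ν : ι → ℕ, Continuous fun a : (ι → Matrix.specialUnitaryGroup (Fin 2) ℂ) =>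
      (∏ e, ((ν e : ℝ) + 1)) * ∫ b, (∏ e, (U ℝ (ν e)).eval (su2a0 (b e * (a e)⁻¹))) * h b ∂μ := fun ν =>
    continuous_charProj ν hh
  have hSi : ∀ ν, Integrable (S ν) μ := fun ν => by
    refine hψ.mul_bdd (continuous_const.mul (hPc ν)).aestronglyMeasurable
      (c := (∏ e, (besselI (ν e) β - besselI (ν e + 2) β) / ((ν e : ℝ) + 1)) *
        ((∏ e, ((ν e : ℝ) + 1)) ^ 2 * ∫ b, |h b| ∂μ)) (Eventually.of_forall fun a => ?_)
    rw [norm_mul, Real.norm_eq_abs, Real.norm_eq_abs, abs_of_nonneg (prod_div_succ_nonneg hβ ν)]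
    exact mul_le_mul_of_nonneg_left (abs_charProj_le ν hh a) (prod_div_succ_nonneg hβ ν)
  have hSn : Summable fun ν : ι → ℕ => ∫ a, ‖S ν a‖ ∂μ := by
    refine Summable.of_nonneg_of_le (fun ν => integral_nonneg fun a => norm_nonneg _) (fun ν => ?_)
      ((summable_prod_succ_mul_besselISub (ι := ι) hβ).1.mul_right
        ((∫ a, |ψ a| ∂μ) * ∫ b, |h b| ∂μ))
    have hb : ∀ a, ‖S ν a‖ ≤ (∏ e, (((ν e : ℝ) + 1) * (besselI (ν e) β - besselI (ν e + 2) β))) *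
        (∫ b, |h b| ∂μ) * |ψ a| := by
      intro a
      simp only [hS]
      rw [Real.norm_eq_abs, abs_mul, abs_mul, abs_of_nonneg (prod_div_succ_nonneg hβ ν), mul_comm |ψ a|]
      refine mul_le_mul_of_nonneg_right ?_ (abs_nonneg _)
      calc (∏ e, (besselI (ν e) β - besselI (ν e + 2) β) / ((ν e : ℝ) + 1)) *
            |(∏ e, ((ν e : ℝ) + 1)) * ∫ b, (∏ e, (U ℝ (ν e)).eval (su2a0 (b e * (a e)⁻¹))) * h b ∂μ|
          ≤ (∏ e, (besselI (ν e) β - besselI (ν e + 2) β) / ((ν e : ℝ) + 1)) *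
              ((∏ e, ((ν e : ℝ) + 1)) ^ 2 * ∫ b, |h b| ∂μ) :=
            mul_le_mul_of_nonneg_left (abs_charProj_le ν hh a) (prod_div_succ_nonneg hβ ν)
        _ = (∏ e, (((ν e : ℝ) + 1) * (besselI (ν e) β - besselI (ν e + 2) β))) * ∫ b, |h b| ∂μ := by
            rw [← mul_assoc, prod_div_succ_mul_prod_succ_sq]
    calc ∫ a, ‖S ν a‖ ∂μ
        ≤ ∫ a, (∏ e, (((ν e : ℝ) + 1) * (besselI (ν e) β - besselI (ν e + 2) β))) * (∫ b, |h b| ∂μ) * |ψ a| ∂μ :=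
          integral_mono_of_nonneg (Eventually.of_forall fun a => norm_nonneg _) (hψ.abs.const_mul _)
            (Eventually.of_forall hb)
      _ = (∏ e, (((ν e : ℝ) + 1) * (besselI (ν e) β - besselI (ν e + 2) β))) *
            ((∫ a, |ψ a| ∂μ) * ∫ b, |h b| ∂μ) := by rw [integral_const_mul]; ring
  rw [← integral_tsum_of_summable_integral_norm hSi hSn]
  refine tsum_congr fun ν => ?_
  simp only [hS]
  have : ∀ a : (ι → Matrix.specialUnitaryGroup (Fin 2) ℂ),
      ψ a * ((∏ e, (besselI (ν e) β - besselI (ν e + 2) β) / ((ν e : ℝ) + 1)) *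
        ((∏ e, ((ν e : ℝ) + 1)) * ∫ b, (∏ e, (U ℝ (ν e)).eval (su2a0 (b e * (a e)⁻¹))) * h b ∂μ)) =
      (∏ e, (besselI (ν e) β - besselI (ν e + 2) β) / ((ν e : ℝ) + 1)) *
        (ψ a * ((∏ e, ((ν e : ℝ) + 1)) * ∫ b, (∏ e, (U ℝ (ν e)).eval (su2a0 (b e * (a e)⁻¹))) * h b ∂μ)) :=
    fun a => by ring
  simp_rw [this]
  rw [integral_const_mul]

end Weight

end Summit.Ventures.YMGap.FlowData.SU2Links
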